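import Summits.AnomalousDissipation.AnomalousDissipation.Theorems.SolenoidalFractalHomogenisationRealisedQuasiStaticCellLawPrincipalLadder
import Summits.AnomalousDissipation.AnomalousDissipation.Theorems.SolenoidalFractalHomogenisationRealisedQuasiStaticCellLawInPlaneFrame
import HarnessLib

/-!
# K2R `RealisedQuasiStaticCellLaw`, line `floquet-bloch`: the in-plane block of a principal ladder — the scalar three-term
# ladder with Leray cosines along the Galerkin solution inside one slot (helper towards `stub_lowSectorDecay` /
# `stub_upperSome`; `--supports stmt-AnomalousDissipation-20446`)

Summits-side helper file (everything proved; no definitions, no named facts). Companion of `…PrincipalLadder`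
(out-of-plane block). Along the coset `k_J = k₀ + J•K_j` of the active slot `j`, let `ζ` be a real unit vector normal to
the plane `span(k₀, K_j)` and `p_J = k̂_J × ζ` the in-plane unit vector transversal to `k_J` (given as a real family `p`
through the hypothesis `hp`). Since the Galerkin state is transversal (`α_N(t)(k) ⊥ k`), it expands in the frame
`(ζ, p_J)` (`frame_expansion`), and the in-plane components `u_J(t) = ⟪p_J, α_N(t)(k_J)⟫` obey, within `[0,T]` at a time
`t` in slot `j`,
`u_J' = -κ4π²|k_J|² u_J - (c_j(t)·2πi(ê_j·k₀)) (a_j (p_J·p_{J-1}) u_{J-1} + a'_j (p_J·p_{J+1}) u_{J+1})`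
(`hasDerivWithinAt_inPlane_slot`): the three-term ladder of STUB-PLAN `stub_lowSectorDecay` §1 «IN-PLANE block, links =
cosines of consecutive polarisation directions».
-/

set_option linter.dupNamespace false

noncomputable section

namespace Summit.AnomalousDissipation.AnomalousDissipation.Theorems.SolenoidalFractalHomogenisation.RealisedQuasiStaticCellLaw

open Set MeasureTheory Filter Topology Function Matrix
open scoped InnerProductSpace ComplexConjugate Matrix
open Literature.Analysis Literature.Analysis.FunctionSpaces Literature.Analysis.FunctionSpaces.Torus
open Literature.Analysis.FluidPDE Literature.Analysis.FluidPDE.LatticeShear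

variable {k₀ : ℕ}

/-! ### Real vectors cast to `ℂ³` -/

/-- Casting commutes with the dot product. -/
theorem ofReal_comp_dotProduct (u v : Fin 3 → ℝ) :
    (Complex.ofReal ∘ u) ⬝ᵥ (Complex.ofReal ∘ v) = (((u ⬝ᵥ v : ℝ)) : ℂ) := by
  simp only [dotProduct, Function.comp_apply]
  push_cast
  rfl

/-- Casting commutes with the cross product. -/
theorem ofReal_comp_cross (u v : Fin 3 → ℝ) :
    (Complex.ofReal ∘ u) ⨯₃ (Complex.ofReal ∘ v) = Complex.ofReal ∘ (u ⨯₃ v) := by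
  ext i
  fin_cases i <;> simp [cross_apply]

/-- Casting commutes with real scalar multiplication. -/
theorem ofReal_comp_smul (r : ℝ) (u : Fin 3 → ℝ) :
    Complex.ofReal ∘ (r • u) = (r : ℂ) • (Complex.ofReal ∘ u) := by
  ext i
  simp

/-- A cast real vector is self-conjugate. -/
theorem star_ofReal_comp (u : Fin 3 → ℝ) : star (Complex.ofReal ∘ u) = Complex.ofReal ∘ u := by
  ext i
  simp [Complex.conj_ofReal]

/-- The inner product of `ℂ³` against a cast real vector is the bilinear dot product. -/
theorem inner_toLp_ofReal_comp (u : Fin 3 → ℝ) (y : EuclideanSpace ℂ (Fin 3)) :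
    inner ℂ (WithLp.toLp 2 (Complex.ofReal ∘ u) : EuclideanSpace ℂ (Fin 3)) y =
      (Complex.ofReal ∘ u) ⬝ᵥ (WithLp.ofLp y) := by
  rw [EuclideanSpace.inner_eq_star_dotProduct, WithLp.ofLp_toLp, star_ofReal_comp, dotProduct_comm]

/-- Lattice frequencies cast through `ℝ` and through `ℤ` agree in `ℂ³`. -/
theorem ofReal_comp_intCast (k : Fin 3 → ℤ) :
    (Complex.ofReal ∘ fun i => ((k i : ℤ) : ℝ)) = fun i => ((k i : ℤ) : ℂ) := by
  ext i
  simp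

/-! ### The in-plane frame of a coset -/

section Frame

variable {k0 K : Fin 3 → ℤ} {ζr : Fin 3 → ℝ}

/-- The normal `ζ` of the plane `span(k₀, K)` is transversal to every frequency of the coset `k₀ + ℤK`. -/
theorem zeta_dot_coset (hζ0 : ζr ⬝ᵥ (fun i => ((k0 i : ℤ) : ℝ)) = 0) (hζK : ζr ⬝ᵥ (fun i => ((K i : ℤ) : ℝ)) = 0)
    (J : ℤ) : ζr ⬝ᵥ (fun i => (((k0 + J • K) i : ℤ) : ℝ)) = 0 := by
  have e : (fun i => (((k0 + J • K) i : ℤ) : ℝ)) = (fun i => ((k0 i : ℤ) : ℝ)) + (J : ℝ) • (fun i => ((K i : ℤ) : ℝ)) := by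
    ext i; simp
  rw [e, dotProduct_add, dotProduct_smul, hζ0, hζK, smul_zero, add_zero]

/-- The in-plane direction `p_J = |k_J|⁻¹ k_J × ζ` is transversal to `k_J`. -/
theorem inPlane_dot_freq (k : Fin 3 → ℤ) (ζr : Fin 3 → ℝ) :
    ((Real.sqrt ((fun i => ((k i : ℤ) : ℝ)) ⬝ᵥ (fun i => ((k i : ℤ) : ℝ))))⁻¹ • (fun i => ((k i : ℤ) : ℝ)) ⨯₃ ζr) ⬝ᵥ
      (fun i => ((k i : ℤ) : ℝ)) = 0 := by
  rw [smul_dotProduct, dotProduct_comm ((fun i => ((k i : ℤ) : ℝ)) ⨯₃ ζr), dot_self_cross, smul_zero]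

/-- The in-plane direction is transversal to `ζ`. -/
theorem inPlane_dot_zeta (k : Fin 3 → ℤ) (ζr : Fin 3 → ℝ) :
    ((Real.sqrt ((fun i => ((k i : ℤ) : ℝ)) ⬝ᵥ (fun i => ((k i : ℤ) : ℝ))))⁻¹ • (fun i => ((k i : ℤ) : ℝ)) ⨯₃ ζr) ⬝ᵥ
      ζr = 0 := by
  rw [smul_dotProduct, dotProduct_comm ((fun i => ((k i : ℤ) : ℝ)) ⨯₃ ζr), dot_cross_self, smul_zero]

/-- **Frame reduction of a pairing**: for a frequency `k ≠ 0` of the coset, a real unit normal `ζ ⊥ k`, the in-plane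
direction `p = |k|⁻¹ k × ζ`, any `x ∈ ℂ³` transversal to `k` and any real `q ⊥ ζ`:
`(cast q)·x = (q·p) · ((cast p)·x)`. -/
theorem dot_of_transversal_frame {k : Fin 3 → ℤ} (hk : k ≠ 0) {ζr : Fin 3 → ℝ} (hζ1 : ζr ⬝ᵥ ζr = 1)
    (hζk : ζr ⬝ᵥ (fun i => ((k i : ℤ) : ℝ)) = 0) {x : Fin 3 → ℂ} (hx : (fun i => ((k i : ℤ) : ℂ)) ⬝ᵥ x = 0)
    {q : Fin 3 → ℝ} (hq : q ⬝ᵥ ζr = 0) :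
    (Complex.ofReal ∘ q) ⬝ᵥ x =
      ((q ⬝ᵥ ((Real.sqrt ((fun i => ((k i : ℤ) : ℝ)) ⬝ᵥ (fun i => ((k i : ℤ) : ℝ))))⁻¹ •
          (fun i => ((k i : ℤ) : ℝ)) ⨯₃ ζr) : ℝ) : ℂ) *
        ((Complex.ofReal ∘ ((Real.sqrt ((fun i => ((k i : ℤ) : ℝ)) ⬝ᵥ (fun i => ((k i : ℤ) : ℝ))))⁻¹ •
          (fun i => ((k i : ℤ) : ℝ)) ⨯₃ ζr)) ⬝ᵥ x) := by
  set kr : Fin 3 → ℝ := fun i => ((k i : ℤ) : ℝ) with hkr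
  set ρ : ℝ := Real.sqrt (kr ⬝ᵥ kr) with hρ
  -- `kr·kr > 0`
  have hkk : 0 < kr ⬝ᵥ kr := by
    obtain ⟨i, hi⟩ : ∃ i, k i ≠ 0 := by
      by_contra h
      push Not at h
      exact hk (funext h)
    have hi' : kr i ≠ 0 := by simp [hkr, hi]
    have : kr ⬝ᵥ kr = ∑ l, kr l ^ 2 := by simp [dotProduct, sq]
    rw [this]
    exact lt_of_lt_of_le (by positivity) (Finset.single_le_sum (fun l _ => sq_nonneg (kr l)) (Finset.mem_univ i))
  have hρpos : 0 < ρ := Real.sqrt_pos.2 hkk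
  have hρsq : ρ ^ 2 = kr ⬝ᵥ kr := Real.sq_sqrt hkk.le
  -- the complex frame `e₁ = cast ζ`, `e₃ = cast k̂`
  set e1 : Fin 3 → ℂ := Complex.ofReal ∘ ζr with he1
  set e3 : Fin 3 → ℂ := Complex.ofReal ∘ (ρ⁻¹ • kr) with he3
  have h11 : e1 ⬝ᵥ e1 = 1 := by rw [he1, ofReal_comp_dotProduct, hζ1]; simp
  have h33 : e3 ⬝ᵥ e3 = 1 := by
    rw [he3, ofReal_comp_dotProduct, smul_dotProduct, dotProduct_smul, smul_eq_mul, smul_eq_mul, ← hρsq]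
    have : ρ⁻¹ * (ρ⁻¹ * ρ ^ 2) = 1 := by field_simp
    rw [this]; simp
  have h31 : e3 ⬝ᵥ e1 = 0 := by
    rw [he3, he1, ofReal_comp_dotProduct, smul_dotProduct, dotProduct_comm, hζk, smul_zero]; simp
  have hx' : x ⬝ᵥ e3 = 0 := by
    rw [he3, ofReal_comp_smul, dotProduct_smul, dotProduct_comm, hkr, ofReal_comp_intCast, hx, smul_zero]
  have hq' : (Complex.ofReal ∘ q) ⬝ᵥ e1 = 0 := by rw [he1, ofReal_comp_dotProduct, hq]; simp
  have hmain := frame_dot_of_transversal e1 e3 x (Complex.ofReal ∘ q) h11 h33 h31 hx' hq'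
  -- identify `e₃ × e₁` with the cast of `p`
  have hp : e3 ⨯₃ e1 = Complex.ofReal ∘ (ρ⁻¹ • kr ⨯₃ ζr) := by
    rw [he3, he1, ofReal_comp_smul, LinearMap.map_smul₂, ofReal_comp_cross, ← ofReal_comp_smul]
  rw [hmain, hp, ofReal_comp_dotProduct]

end Frame

/-! ### The in-plane ladder along the Galerkin solution -/

/-- **The in-plane scalar ladder along the Galerkin solution, inside slot `j`** (links = Leray cosines). Data: the cell
Galerkin data (`pvSetup_cell`), `N` resolving the carrier, `t ∈ [0,T]` in slot `j`, a coset `k₀ + ℤK_j` none of whose points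
in the ball is the zero frequency, a real unit normal `ζ` of `span(k₀, K_j)`, the in-plane directions
`p_J = |k_J|⁻¹ k_J × ζ`, and `J` with `k_J ∈ freqBall N`. Then `u_J = ⟪p_J, α_N(·)(k_J)⟫` satisfies within `[0,T]` at `t`
`u_J' = -κ4π²|k_J|² u_J(t) - (c_j(t)·2πi(ê_j·k₀)) (a_j (p_J·p_{J-1}) u_{J-1}(t) + a'_j (p_J·p_{J+1}) u_{J+1}(t))`. -/
theorem hasDerivWithinAt_inPlane_slot (W : LatticeWord k₀) {n : ℕ} (hn : 0 < n) {κ : ℝ} (hκ : 0 ≤ κ)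
    (ℓ : Fin 3 → ℤ) {w₀ : UnitAddTorus (Fin 3) → EuclideanSpace ℝ (Fin 3)}
    (hw₀ : FunctionSpaces.Torus.MemSobolev 1 (FunctionSpaces.EuclideanSpace.complexify ∘ w₀))
    (hdiv : FunctionSpaces.Torus.IsWeaklyDivFree w₀) (hmean : FunctionSpaces.Torus.HasZeroMean w₀)
    (hsupp : ∀ k : Fin 3 → ℤ, ¬ ((∃ z : Fin 3 → ℤ, k = ℓ + (n:ℤ) • z) ∨ (∃ z : Fin 3 → ℤ, k = -ℓ + (n:ℤ) • z)) →
      UnitAddTorus.mFourierCoeff (FunctionSpaces.EuclideanSpace.complexify ∘ w₀) k = 0)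
    {N : ℕ} (hBN : (Finset.univ.biUnion fun j : Fin k₀ =>
        ({(fun i => (W.phase j).m i * n), -(fun i => (W.phase j).m i * n)} : Finset (Fin 3 → ℤ))) ⊆ freqBall N)
    {T t : ℝ} (htT : t ∈ Icc 0 T) (j : Fin k₀)
    (ht : Int.fract (t / W.period) * W.period ∈ Icc (W.start j) (W.start j + (W.phase j).τ))
    (k0 : Fin 3 → ℤ) (hk : ∀ J : ℤ, k0 + J • (fun i => (W.phase j).m i * (n : ℤ)) ∈ freqBall N →
      k0 + J • (fun i => (W.phase j).m i * (n : ℤ)) ≠ 0)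
    {ζr : Fin 3 → ℝ} (hζ1 : ζr ⬝ᵥ ζr = 1) (hζ0 : ζr ⬝ᵥ (fun i => ((k0 i : ℤ) : ℝ)) = 0)
    (hζK : ζr ⬝ᵥ (fun i => (((fun i => (W.phase j).m i * (n : ℤ)) i : ℤ) : ℝ)) = 0)
    {p : ℤ → Fin 3 → ℝ}
    (hp : ∀ J : ℤ, p J = (Real.sqrt ((fun i => (((k0 + J • (fun i => (W.phase j).m i * (n : ℤ))) i : ℤ) : ℝ)) ⬝ᵥ
        (fun i => (((k0 + J • (fun i => (W.phase j).m i * (n : ℤ))) i : ℤ) : ℝ))))⁻¹ •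
        (fun i => (((k0 + J • (fun i => (W.phase j).m i * (n : ℤ))) i : ℤ) : ℝ)) ⨯₃ ζr)
    (J : ℤ) (hJ : k0 + J • (fun i => (W.phase j).m i * (n : ℤ)) ∈ freqBall N) :
    HasDerivWithinAt
      (fun τ => inner ℂ (WithLp.toLp 2 (Complex.ofReal ∘ p J) : EuclideanSpace ℂ (Fin 3))
        ((pvSetup_cell W hn hκ ℓ hw₀ hdiv hmean hsupp).galerkinCoeffAt N τ
          (k0 + J • (fun i => (W.phase j).m i * (n : ℤ)))))
      (-((((κ * (4 * Real.pi ^ 2 * freqNormSq (k0 + J • (fun i => (W.phase j).m i * (n : ℤ))))) : ℝ) : ℂ) *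
          inner ℂ (WithLp.toLp 2 (Complex.ofReal ∘ p J) : EuclideanSpace ℂ (Fin 3))
            ((pvSetup_cell W hn hκ ℓ hw₀ hdiv hmean hsupp).galerkinCoeffAt N t
              (k0 + J • (fun i => (W.phase j).m i * (n : ℤ))))) -
        (2 * Real.pi * Complex.I * ∑ i, (EuclideanSpace.complexify (W.phase j).e) i * (k0 i : ℂ)) *
          ((((1 / (n : ℝ)) * LatticeWord.trapezoid (W.start j) (W.phase j).τ W.ramp
                (Int.fract (t / W.period) * W.period) : ℝ) : ℂ) *
              (Complex.exp ((W.phase j).φ * Complex.I) *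
                (1 / (2 * ((2 * Real.pi * ‖latticeVec (W.phase j).m‖ : ℝ) : ℂ) * Complex.I))) *
              ((((p J ⬝ᵥ p (J - 1) : ℝ)) : ℂ) *
                inner ℂ (WithLp.toLp 2 (Complex.ofReal ∘ p (J - 1)) : EuclideanSpace ℂ (Fin 3))
                  ((pvSetup_cell W hn hκ ℓ hw₀ hdiv hmean hsupp).galerkinCoeffAt N t
                    (k0 + (J - 1) • (fun i => (W.phase j).m i * (n : ℤ))))) +
            (((1 / (n : ℝ)) * LatticeWord.trapezoid (W.start j) (W.phase j).τ W.ramp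
                (Int.fract (t / W.period) * W.period) : ℝ) : ℂ) *
              (starRingEnd ℂ (Complex.exp ((W.phase j).φ * Complex.I)) *
                (-(1 / (2 * ((2 * Real.pi * ‖latticeVec (W.phase j).m‖ : ℝ) : ℂ) * Complex.I)))) *
              ((((p J ⬝ᵥ p (J + 1) : ℝ)) : ℂ) *
                inner ℂ (WithLp.toLp 2 (Complex.ofReal ∘ p (J + 1)) : EuclideanSpace ℂ (Fin 3))
                  ((pvSetup_cell W hn hκ ℓ hw₀ hdiv hmean hsupp).galerkinCoeffAt N t
                    (k0 + (J + 1) • (fun i => (W.phase j).m i * (n : ℤ)))))))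
      (Icc 0 T) t := by
  classical
  set hPV := pvSetup_cell W hn hκ ℓ hw₀ hdiv hmean hsupp with hPVdef
  set K : Fin 3 → ℤ := fun i => (W.phase j).m i * (n : ℤ) with hK
  set pc : ℤ → EuclideanSpace ℂ (Fin 3) := fun J' => WithLp.toLp 2 (Complex.ofReal ∘ p J') with hpc
  -- the mode equation tested against `p_J`
  have h1 := hPV.hasDerivWithinAt_inner_galerkinCoeffAt hBN hJ htT (pc J)
  refine h1.congr_deriv ?_
  rw [carrierCoeff_slot_eq_layer W hn j ht]
  have hK0 : K ≠ 0 := cellFreq_ne_zero (W.phase j) hn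
  have hKS : K ∈ freqBall N := hBN (Finset.mem_biUnion.2 ⟨j, Finset.mem_univ _, Finset.mem_insert_self _ _⟩)
  have hKS' : -K ∈ freqBall N :=
    hBN (Finset.mem_biUnion.2 ⟨j, Finset.mem_univ _, Finset.mem_insert_of_mem (Finset.mem_singleton_self _)⟩)
  have he : ∑ i, ((K i : ℤ) : ℂ) * (EuclideanSpace.complexify (W.phase j).e) i = 0 :=
    sum_cellFreq_mul_complexify_e (W.phase j) n
  have hc : ∀ m, m ∉ freqBall N → hPV.galerkinCoeffAt N t m = 0 := fun m hm => by
    rw [Torus.PVSetup.galerkinCoeffAt, coeffExt_of_not_mem _ hm]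
  -- `p_J ⊥ k_J` as a complex transversality
  have hpJ : ∑ i, (((k0 + J • K) i : ℤ) : ℂ) * (pc J) i = 0 := by
    have h0 := inPlane_dot_freq (k0 + J • K) ζr
    rw [← hp J] at h0
    have : ∑ i, (((k0 + J • K) i : ℤ) : ℂ) * (pc J) i = (((p J ⬝ᵥ fun i => (((k0 + J • K) i : ℤ) : ℝ) : ℝ)) : ℂ) := by
      rw [dotProduct]; push_cast
      refine Finset.sum_congr rfl fun i _ => ?_
      simp [hpc, mul_comm]
    rw [this, h0]; simp
  rw [Torus.inner_pvGalerkinField_layer κ hK0 hKS hKS' he _ _ hc hpJ, Torus.sum_mul_coset_eq he]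
  -- neighbours on the coset
  have em : k0 + J • K - K = k0 + (J - 1) • K := by rw [sub_smul, one_smul]; abel
  have ep : k0 + J • K + K = k0 + (J + 1) • K := by rw [add_smul, one_smul]; abel
  rw [em, ep]
  -- the frame reduction `⟪p_J, α(k_{J∓1})⟫ = (p_J·p_{J∓1}) ⟪p_{J∓1}, α(k_{J∓1})⟫`
  have hred : ∀ J' : ℤ, inner ℂ (pc J) (hPV.galerkinCoeffAt N t (k0 + J' • K)) =
      (((p J ⬝ᵥ p J' : ℝ)) : ℂ) * inner ℂ (pc J') (hPV.galerkinCoeffAt N t (k0 + J' • K)) := by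
    intro J'
    by_cases hJ' : k0 + J' • K ∈ freqBall N
    · have hne : k0 + J' • K ≠ 0 := hk J' hJ'
      simp only [hpc]
      rw [inner_toLp_ofReal_comp, inner_toLp_ofReal_comp]
      have hx : (fun i => (((k0 + J' • K) i : ℤ) : ℂ)) ⬝ᵥ WithLp.ofLp (hPV.galerkinCoeffAt N t (k0 + J' • K)) = 0 := by
        rw [dotProduct]
        exact hPV.sum_mul_galerkinCoeffAt N t (k0 + J' • K)
      have hq : p J ⬝ᵥ ζr = 0 := by rw [hp J]; exact inPlane_dot_zeta _ _
      rw [dot_of_transversal_frame hne hζ1 (zeta_dot_coset hζ0 hζK J') hx hq, ← hp J']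
    · rw [hc _ hJ', inner_zero_right, inner_zero_right, mul_zero]
  rw [hred (J - 1), hred (J + 1)]

end Summit.AnomalousDissipation.AnomalousDissipation.Theorems.SolenoidalFractalHomogenisation.RealisedQuasiStaticCellLaw

end
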